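import Literature.MathematicalPhysics.QuantumFieldTheory.Balaban1983to89.B5G183RateWTheta
import Literature.Computability.QuantumComplexity.SolovayKitaev.Basic

/-!
# Bałaban [CMP 95 (1984)] Prop. 1.1 (1.89) at `U = 1`, order two, weights `W^θ∂ ⊗ W^θ∂`: NO eta-rate
`N^{−γ}` with `γ > 2θ` (`0 ≤ θ < 1`) — the unpaired on-axis alias classes

HONEST FRAMING (cell `pub-balaban`, T⁴ programme, estimate NE2 = U1a «η-rate, linear theory»).  Finite
torus, `η = 1/n`, trivial background `U = 1`, one nonzero reduced momentum at a time, `ℓ²`-operator norm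
on the alias classes.  A NEGATIVE result about OUR currency (`B5G183RateWTheta.OrderTwoOpRateResidualWθ`:
the planted difference of the sandwiches `D_{W^θ∂ν} G D*_{W^θ∂ν′}` between the levels `N` and `RN`);
nothing here is about infinite volume, `U ≠ 1`, a mass gap, or any summit statement, and it says nothing
against the printed, rate-free Proposition 1.1.

WHAT IS PRINTED.  [Balaban1984PropagatorsI] p. 33: «Proposition 1.1. The operator G is a symmetric
operator on L²(T_η) and ‖GJ‖, ‖∇GJ‖, ‖G∇*J‖, ‖∇G∇*J‖, ‖∇∇GJ‖, ‖G∇*∇*J‖ ≤ γ₀⁻¹‖J‖, (1.89) with a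
positive constant γ₀ independent of k, T_η, and depending on d only (if we put a = 1).» — NO rate in η
is printed.  [King1986] p. 672 (4.20)
`|u(p′+l)| ≤ Π_μ |p′_μ||p′_μ + l_μ|⁻¹`, (4.22) «≤ C for α < 1.», (4.23) «≤ CL^{−γk} for α + γ < 1»; p. 673
«So keeping γ + α < 1, the error produced by the above replacement is bounded by CL^{−γk}.»  (renders
ref1 p017, king p024/p025, read as images by this lineage.)

WHAT THIS MODULE PROVES (kernel, [folklore]).  **`not_orderTwoOpRateResidualWθ_of_lt`**: for `d ≥ 1`
(a direction `μ₁`), `a > 0`, `0 ≤ θ < 1` and every `γ > 2θ`, `¬ OrderTwoOpRateResidualWθ d a C θ γ` for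
every constant `C`.  WITNESS: `R = 2`, level `2N` with `N = M + 2`, fibre `p′ = π e_{μ₁}`
(`B5G183RateObstruction.sWit`), the ON-AXIS class `K = (N−1) e_{μ₁}` of level `2N` (`KW`): its
symmetric representative is `q̃ = π(2N−1) e_{μ₁}` (`symmAlias_KW`), so it is one of King's `|m| ≥ 1`
classes — NOT of the form `ι₂ k` (`KW_unpaired`) — and the planted level-`N` term vanishes on its row
(`B5G183RateOp.plant_row_unpaired`); its King weight is `W = 1/(2N−1)` (`Wc_KW`), and the diagonal
entry of the level-`2N` sandwich is `(W^θ)²·|∂|²/Δ + junk = (1/(2N−1))^{2θ} + O(1/N²)` (`main_KW`,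
`junk_KW_le` via `B5G183RateObstructionOp.junk_le`).  An operator bound `C/N^γ` dominates this entry
(`SolovayKitaev.norm_apply_le_norm`), and `(2N−1)^{−2θ} ≥ ¼N^{−2θ}` beats `C/N^γ + Cj/N²` for `N`
large once `γ > 2θ` and `2θ < 2` (`numeric_coreθ`).  At `θ = 0` this says the unweighted order-two
residual has no rate `N^{−γ}` for ANY `γ > 0`, already in `d = 1` (compare
`B5G183RateObstructionOp.not_orderTwoOpRateResidual`: no rate `1/N`, `d ≥ 2`, paired witness).

NOT CLAIMED: anything for `θ = 1` or `γ ≤ 2θ` (the positive side is a separate module), sharpness of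
the rate `1/N` of the finite-rank pieces for `θ > 1/2`, `U ≠ 1`, constants.
-/

noncomputable section

namespace Literature.MathematicalPhysics.QuantumFieldTheory.Balaban1983to89.B5G183RateWThetaSharp

open scoped BigOperators ComplexConjugate Matrix.Norms.L2Operator
open Finset Complex
open Literature.MathematicalPhysics.QuantumFieldTheory.Balaban1983to89.B4Strip
open Literature.MathematicalPhysics.QuantumFieldTheory.Balaban1983to89.B5Prop11Fiber
open Literature.MathematicalPhysics.QuantumFieldTheory.Balaban1983to89.B5Prop11Bound
open Literature.MathematicalPhysics.QuantumFieldTheory.Balaban1983to89.B5Hk163Rate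
open Literature.MathematicalPhysics.QuantumFieldTheory.Balaban1983to89.B5Hk163RateSum
open Literature.MathematicalPhysics.QuantumFieldTheory.Balaban1983to89.B5G183Rate
open Literature.MathematicalPhysics.QuantumFieldTheory.Balaban1983to89.B5G183RateSum
open Literature.MathematicalPhysics.QuantumFieldTheory.Balaban1983to89.B5G183RateL2
open Literature.MathematicalPhysics.QuantumFieldTheory.Balaban1983to89.B5G183RateOp
open Literature.MathematicalPhysics.QuantumFieldTheory.Balaban1983to89.B5G183RateObstruction
open Literature.MathematicalPhysics.QuantumFieldTheory.Balaban1983to89.B5G183RateObstructionOp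
open Literature.MathematicalPhysics.QuantumFieldTheory.Balaban1983to89.B5G183RateO2Diag
open Literature.MathematicalPhysics.QuantumFieldTheory.Balaban1983to89.B5G183RateO2Op
open Literature.MathematicalPhysics.QuantumFieldTheory.Balaban1983to89.B5G183RateWTheta
open Literature.MathematicalPhysics.QuantumFieldTheory.King1986
open Literature.Computability.QuantumComplexity.SolovayKitaev (norm_apply_le_norm)

variable {d : ℕ}

/-! ## §1 The witness class `K = (N−1)·e_{μ₁}` of level `2N`, `N = M + 2` [folklore] -/

section Witness

/-- the level-`2N` on-axis class `(N−1)·e_{μ₁}`, `N = M + 2`. [folklore] -/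
def KW (M : ℕ) (μ₁ : Fin d) : Fin d → Fin (2 * (M + 2)) :=
  fun μ => if μ = μ₁ then ⟨M + 1, by omega⟩ else ⟨0, by omega⟩

/-- its shifted momentum `p′ + 2πK = π(2N−1) e_{μ₁}` at `p′ = π e_{μ₁}`. [folklore] -/
theorem shiftr_KW (M : ℕ) (μ₁ μ : Fin d) :
    shiftr (2 * (M + 2)) (KW M μ₁) (sWit μ₁) μ = if μ = μ₁ then Real.pi * (2 * M + 3) else 0 := by
  unfold shiftr sWit KW
  split_ifs with h
  · push_cast; ring
  · push_cast; ring

/-- no folding: `π(2N−1) ≤ π·2N`, so King's pull-back count vanishes. [cite: King1986, (4.19) p.672]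
[folklore] -/
theorem symmShift_KW (M : ℕ) (μ₁ μ : Fin d) : symmShift (2 * (M + 2)) (KW M μ₁) (sWit μ₁) μ = 0 := by
  unfold symmShift
  rw [shiftr_KW, if_neg]
  have hM : (0 : ℝ) ≤ M := Nat.cast_nonneg M
  have hπ := Real.pi_pos
  split_ifs
  · push_cast; nlinarith
  · exact not_lt.mpr (by positivity)

/-- the symmetric representative `q̃_K = π(2N−1) e_{μ₁}`. [cite: King1986, (4.19) p.672] [folklore] -/
theorem symmAlias_KW (M : ℕ) (μ₁ μ : Fin d) :
    symmAlias (2 * (M + 2)) (KW M μ₁) (sWit μ₁) μ = if μ = μ₁ then Real.pi * (2 * M + 3) else 0 := by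
  unfold symmAlias
  rw [symmShift_KW, shiftr_KW]
  push_cast
  ring

/-- King's integer label `j = (N−1) e_{μ₁} ≠ 0`. [folklore] -/
theorem jOf_KW (M : ℕ) (μ₁ μ : Fin d) :
    jOf (2 * (M + 2)) (KW M μ₁) (sWit μ₁) μ = if μ = μ₁ then ((M : ℤ) + 1) else 0 := by
  unfold jOf
  rw [symmShift_KW]
  unfold KW
  split_ifs <;> simp

/-- **`K` is one of King's `|m| ≥ 1` classes:** it is not `ι₂ k` for any level-`N` class `k`
(`|q̃_{K,μ₁}| = π(2N−1) > πN`). [cite: King1986, (4.19), (4.24) pp.672–673] [folklore] -/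
theorem KW_unpaired (M : ℕ) (μ₁ : Fin d) :
    ∀ k : Fin d → Fin (M + 2), iota 2 k (sWit μ₁) ≠ KW M μ₁ := by
  intro k hk
  have hN : 1 ≤ M + 2 := by omega
  have hs := (sWit_zone_ne_zero μ₁).1
  have hz := (isRep_symmAlias hN k hs).zone μ₁
  rw [← symmAlias_iota (R := 2) hN k hs, hk, symmAlias_KW, if_pos rfl,
    abs_of_pos (by positivity)] at hz
  push_cast at hz
  have hM : (0 : ℝ) ≤ M := Nat.cast_nonneg M
  nlinarith [Real.pi_pos]

/-- its King weight `W = |π|/|π + 2π(N−1)| = 1/(2N−1)`. [cite: King1986, (4.20) p.672] [folklore] -/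
theorem Wc_KW (M : ℕ) (μ₁ : Fin d) : Wc (2 * (M + 2)) (KW M μ₁) (sWit μ₁) = 1 / (2 * M + 3) := by
  have hπ := Real.pi_pos
  have hM : (0 : ℝ) ≤ M := Nat.cast_nonneg M
  unfold Wc aliasWeight
  rw [← Finset.mul_prod_erase Finset.univ _ (Finset.mem_univ μ₁)]
  have h1 : ∀ μ ∈ Finset.univ.erase μ₁,
      (if jOf (2 * (M + 2)) (KW M μ₁) (sWit μ₁) μ = 0 then (1 : ℝ)
        else |sWit μ₁ μ| / |sWit μ₁ μ + 2 * Real.pi * (jOf (2 * (M + 2)) (KW M μ₁) (sWit μ₁) μ : ℝ)|)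
        = 1 := by
    intro μ hμ
    rw [jOf_KW, if_neg (Finset.mem_erase.mp hμ).1, if_pos rfl]
  rw [Finset.prod_eq_one h1, mul_one, jOf_KW, if_pos rfl, if_neg (by omega)]
  unfold sWit
  rw [if_pos rfl]
  push_cast
  rw [abs_of_pos hπ, abs_of_pos (by positivity)]
  field_simp
  ring

/-- `|∂^{(2N)}_{μ₁}(q̃_K)|² = S^{(2N)}(π(2N−1))`. [folklore] -/
theorem normSq_dSym_KW (M : ℕ) (μ₁ : Fin d) :
    ‖dSym (2 * (M + 2)) (KW M μ₁) (sWit μ₁) μ₁‖ ^ 2 = Sxir (2 * (M + 2)) (Real.pi * (2 * M + 3)) := by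
  rw [norm_dSym_sq, shiftr_KW, if_pos rfl]

/-- `Δ^{(2N)}(q̃_K) = S^{(2N)}(π(2N−1))` (massless, one nonzero coordinate). [folklore] -/
theorem DeltaXir_KW (M : ℕ) (μ₁ : Fin d) :
    DeltaXir (2 * (M + 2)) 0 (symmAlias (2 * (M + 2)) (KW M μ₁) (sWit μ₁))
      = Sxir (2 * (M + 2)) (Real.pi * (2 * M + 3)) := by
  unfold DeltaXir
  rw [add_zero, ← Finset.add_sum_erase Finset.univ _ (Finset.mem_univ μ₁), symmAlias_KW, if_pos rfl,
    Finset.sum_eq_zero (fun μ hμ => by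
      rw [symmAlias_KW, if_neg (Finset.mem_erase.mp hμ).1, B5G183RateObstruction.Sxir_zero]),
    add_zero]

/-- `S^{(2N)}(π(2N−1)) = 4(2N)² sin²(π(2N−1)/(4N)) > 0`. [folklore] -/
theorem Sxir_KW_pos (M : ℕ) : 0 < Sxir (2 * (M + 2)) (Real.pi * (2 * M + 3)) := by
  rw [Sxir_eq]
  have hπ := Real.pi_pos
  have hM : (0 : ℝ) ≤ M := Nat.cast_nonneg M
  have hn : (0 : ℝ) < ((2 * (M + 2) : ℕ) : ℝ) := by positivity
  have harg : Real.pi * (2 * M + 3) / (2 * ((2 * (M + 2) : ℕ) : ℝ))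
      = Real.pi * ((2 * M + 3) / (4 * M + 8)) := by
    push_cast; field_simp; ring
  have h0 : 0 < Real.pi * ((2 * M + 3) / (4 * M + 8)) := by positivity
  have h1 : Real.pi * ((2 * M + 3) / (4 * M + 8)) < Real.pi := by
    have : (2 * (M : ℝ) + 3) / (4 * M + 8) < 1 := by
      rw [div_lt_one (by positivity)]; linarith
    nlinarith
  have hs := Real.sin_pos_of_pos_of_lt_pi h0 h1
  rw [harg]
  exact mul_pos (mul_pos (by norm_num) (pow_pos hn 2)) (pow_pos hs 2)

/-- **the main term:** `(|W^θ∂_{μ₁}(q̃_K)|²)·Δ(q̃_K)⁻¹ = (1/(2N−1))^{2θ}`. [folklore] -/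
theorem main_KW (M : ℕ) (μ₁ : Fin d) (θ : ℝ) :
    ((‖wθdSym (2 * (M + 2)) θ (KW M μ₁) (sWit μ₁) μ₁‖ ^ 2 : ℝ) : ℂ)
        * (((DeltaXir (2 * (M + 2)) 0 (symmAlias (2 * (M + 2)) (KW M μ₁) (sWit μ₁)) : ℝ) : ℂ))⁻¹
      = (((((1 : ℝ) / (2 * M + 3)) ^ θ) ^ 2 : ℝ) : ℂ) := by
  have hS := Sxir_KW_pos M
  have hW0 : 0 ≤ Wc (2 * (M + 2)) (KW M μ₁) (sWit μ₁) :=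
    (Wc_nonneg_le_one (n := 2 * (M + 2)) (KW M μ₁) (sWit_zone_ne_zero μ₁).1).1
  rw [← Complex.ofReal_inv, ← Complex.ofReal_mul, DeltaXir_KW]
  congr 1
  unfold wθdSym
  rw [norm_mul, mul_pow, Complex.norm_real, Real.norm_eq_abs,
    abs_of_nonneg (Real.rpow_nonneg hW0 θ), normSq_dSym_KW, Wc_KW, mul_assoc,
    mul_inv_cancel₀ hS.ne', mul_one]

/-- **the junk** (x-corner and bracket of (1.83) at the witness class, times `|W^θ∂|²`) is `≤ Cj/N²`
(`B5G183RateObstructionOp.junk_le` with `L = ‖q̃_K‖_∞ = π(2N−1)`, `|W^θ∂|² ≤ |∂|² ≤ L²`).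
[cite: Balaban1984PropagatorsI, (1.83) p.31; King1986, (4.20) p.672] [folklore] -/
theorem junk_KW_le (M : ℕ) (μ₁ : Fin d) (a : ℝ) (ha : 0 < a) {θ : ℝ} (hθ : 0 ≤ θ) :
    ‖((‖wθdSym (2 * (M + 2)) θ (KW M μ₁) (sWit μ₁) μ₁‖ ^ 2 : ℝ) : ℂ)
        * (rEnt (2 * (M + 2)) a μ₁ μ₁ (sWit μ₁) (KW M μ₁) (KW M μ₁)
            - xEnt (2 * (M + 2)) a μ₁ (sWit μ₁) (KW M μ₁) (KW M μ₁))‖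
      ≤ Cjunk d a / ((M + 2 : ℕ) : ℝ) ^ 2 := by
  have hs := (sWit_zone_ne_zero μ₁).1
  have hn : 1 ≤ 2 * (M + 2) := by omega
  have hπ := Real.pi_pos
  have hM : (0 : ℝ) ≤ M := Nat.cast_nonneg M
  have hγ := T4GaugeActionRate.gam0_pos d
  set L : ℝ := Real.pi * (2 * M + 3) with hL
  have hL0 : 0 < L := by positivity
  have hw : ‖wθdSym (2 * (M + 2)) θ (KW M μ₁) (sWit μ₁) μ₁‖ ^ 2 ≤ L ^ 2 :=
    calc ‖wθdSym (2 * (M + 2)) θ (KW M μ₁) (sWit μ₁) μ₁‖ ^ 2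
        ≤ ‖dSym (2 * (M + 2)) (KW M μ₁) (sWit μ₁) μ₁‖ ^ 2 :=
          pow_le_pow_left₀ (norm_nonneg _) (norm_wθdSym_le hθ _ hs μ₁) 2
      _ = Sxir (2 * (M + 2)) L := normSq_dSym_KW M μ₁
      _ ≤ L ^ 2 := Sxir_le _ _
  have hk : jOf (2 * (M + 2)) (KW M μ₁) (sWit μ₁) ≠ 0 := by
    intro h
    have h1 := congrFun h μ₁
    rw [jOf_KW, if_pos rfl, Pi.zero_apply] at h1
    omega
  have hq : ‖symmAlias (2 * (M + 2)) (KW M μ₁) (sWit μ₁)‖ = L := by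
    apply le_antisymm
    · refine (pi_norm_le_iff_of_nonneg hL0.le).mpr fun μ => ?_
      rw [Real.norm_eq_abs, symmAlias_KW]
      split_ifs
      · rw [abs_of_pos hL0]
      · rw [abs_zero]; exact hL0.le
    · have h := norm_le_pi_norm (symmAlias (2 * (M + 2)) (KW M μ₁) (sWit μ₁)) μ₁
      rwa [symmAlias_KW, if_pos rfl, Real.norm_eq_abs, abs_of_pos hL0] at h
  have hW1 := aliasWeight_le_one hs (jOf (2 * (M + 2)) (KW M μ₁) (sWit μ₁))
  have hx : xM (2 * (M + 2)) (sWit μ₁) μ₁ (KW M μ₁) ≤ CXa d / L ^ 2 := by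
    refine (xM_le_W_div_sq hs μ₁ hk).trans ?_
    rw [hq]
    exact div_le_div_of_nonneg_right
      (by simpa using mul_le_mul_of_nonneg_left hW1 (CXa_nonneg d)) (by positivity)
  have hb : bM (2 * (M + 2)) a (sWit μ₁) μ₁ (KW M μ₁) ≤ CBa d / L ^ 2 := by
    refine (bM_le_W_div_sq hn a hs μ₁ hk).trans ?_
    rw [hq]
    exact div_le_div_of_nonneg_right
      (by simpa using mul_le_mul_of_nonneg_left hW1 (CBa_nonneg d)) (by positivity)
  have h := junk_le hn a ha hs μ₁ (sWit_self_ne_zero μ₁) μ₁ (KW M μ₁) _ hL0 hw (CXa_nonneg d)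
    (CBa_nonneg d) hx hb
  refine h.trans ?_
  have e : ((4 * d + a) / a * CBa d ^ 2 + 4 * d / T4GaugeActionRate.gam0 d * CXa d ^ 2) / L ^ 2
      = Cjunk d a / (2 * M + 3) ^ 2 := by
    rw [hL, Cjunk, div_div, ← mul_pow]
  rw [e]
  refine div_le_div_of_nonneg_left (Cjunk_nonneg d ha) (by positivity) ?_
  push_cast
  nlinarith

/-- the planted order-two `W^θ` difference at the witness: `R = 2`, level `N = M+2`, fibre `π e_{μ₁}`,
directions `(μ₁, μ₁)`. [folklore] -/
def XW (M : ℕ) [NeZero (M + 2)] (μ₁ : Fin d) (a : ℝ) (ha : 0 < a) (θ : ℝ) :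
    Matrix ((Fin d → Fin (2 * (M + 2))) × Fin d) ((Fin d → Fin (2 * (M + 2))) × Fin d) ℂ :=
  sandwich (fun K => wθdSym (2 * (M + 2)) θ K (sWit μ₁) μ₁) (fun K => wθdSym (2 * (M + 2)) θ K (sWit μ₁) μ₁)
      (balabanFiber (2 * (M + 2)) (by omega) a ha (sWit μ₁) (sWit_zone_ne_zero μ₁).1
        (sWit_zone_ne_zero μ₁).2).G
    - plant 2 (sWit μ₁) (sandwich (fun k => wθdSym (M + 2) θ k (sWit μ₁) μ₁)
        (fun k => wθdSym (M + 2) θ k (sWit μ₁) μ₁)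
        (balabanFiber (M + 2) (by omega) a ha (sWit μ₁) (sWit_zone_ne_zero μ₁).1
          (sWit_zone_ne_zero μ₁).2).G)

/-- an `OrderTwoOpRateResidualWθ` bound specialised to the witness. [folklore] -/
theorem opNorm_XW_le {a C θ γ : ℝ} (h : OrderTwoOpRateResidualWθ d a C θ γ) (M : ℕ) [NeZero (M + 2)]
    (μ₁ : Fin d) (ha : 0 < a) : ‖XW M μ₁ a ha θ‖ ≤ C / ((M + 2 : ℕ) : ℝ) ^ γ :=
  h (M + 2) 2 (by omega) (by omega) ha (sWit μ₁) (sWit_zone_ne_zero μ₁).1 (sWit_zone_ne_zero μ₁).2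
    μ₁ μ₁ (by norm_num)

/-- **the witness entry of `XW`:** the planted term vanishes on the row of the unpaired class `K`, and the
level-`2N` sandwich entry is `W^θ∂·G^{(2N)}(K,K)_{μ₁μ₁}·conj(W^θ∂)`. [folklore] -/
theorem XW_entry (M : ℕ) [NeZero (M + 2)] (μ₁ : Fin d) (a : ℝ) (ha : 0 < a) (θ : ℝ) :
    XW M μ₁ a ha θ (KW M μ₁, μ₁) (KW M μ₁, μ₁)
      = wθdSym (2 * (M + 2)) θ (KW M μ₁) (sWit μ₁) μ₁
          * Gfor (2 * (M + 2)) a (sWit μ₁) μ₁ μ₁ (KW M μ₁) (KW M μ₁)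
          * conj (wθdSym (2 * (M + 2)) θ (KW M μ₁) (sWit μ₁) μ₁) := by
  unfold XW
  rw [Matrix.sub_apply, plant_row_unpaired _ (KW_unpaired M μ₁), sub_zero]
  simp only [sandwich, G_entry]

end Witness

/-! ## §2 The numeric core and the theorem [folklore] -/

section NoGo

/-- numeric core: `1/(4N^{2θ}) ≤ C/N^γ + Cj/N²` is impossible for `N ≥ (8|C|+1)^{1/(γ−2θ)}`,
`N ≥ (8Cj+1)^{1/(2−2θ)}`, `N ≥ 2` (`γ > 2θ`, `θ < 1`). [folklore] -/
theorem numeric_coreθ {C Cj N θ γ : ℝ} (hN : 2 ≤ N) (hθ1 : θ < 1) (hγ : 2 * θ < γ) (hCj : 0 ≤ Cj)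
    (hm : 1 / (4 * N ^ (2 * θ)) ≤ C / N ^ γ + Cj / N ^ 2)
    (hT₁ : (8 * |C| + 1) ^ (1 / (γ - 2 * θ)) ≤ N) (hT₂ : (8 * Cj + 1) ^ (1 / (2 - 2 * θ)) ≤ N) :
    False := by
  have hN0 : 0 < N := by linarith
  set ε₁ := γ - 2 * θ with hε₁d
  set ε₂ := 2 - 2 * θ with hε₂d
  have hε₁ : 0 < ε₁ := by rw [hε₁d]; linarith
  have hε₂ : 0 < ε₂ := by rw [hε₂d]; linarith
  have hP : 0 < N ^ (2 * θ) := Real.rpow_pos_of_pos hN0 _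
  have hE₁ : 0 < N ^ ε₁ := Real.rpow_pos_of_pos hN0 _
  have hE₂ : 0 < N ^ ε₂ := Real.rpow_pos_of_pos hN0 _
  have h1 : 8 * |C| + 1 ≤ N ^ ε₁ := by
    have h0 : 0 ≤ 8 * |C| + 1 := by positivity
    calc 8 * |C| + 1 = ((8 * |C| + 1) ^ (1 / ε₁)) ^ ε₁ := by
          rw [← Real.rpow_mul h0, one_div_mul_cancel hε₁.ne', Real.rpow_one]
      _ ≤ N ^ ε₁ := Real.rpow_le_rpow (Real.rpow_nonneg h0 _) hT₁ hε₁.le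
  have h2 : 8 * Cj + 1 ≤ N ^ ε₂ := by
    have h0 : 0 ≤ 8 * Cj + 1 := by positivity
    calc 8 * Cj + 1 = ((8 * Cj + 1) ^ (1 / ε₂)) ^ ε₂ := by
          rw [← Real.rpow_mul h0, one_div_mul_cancel hε₂.ne', Real.rpow_one]
      _ ≤ N ^ ε₂ := Real.rpow_le_rpow (Real.rpow_nonneg h0 _) hT₂ hε₂.le
  have hγsplit : N ^ γ = N ^ (2 * θ) * N ^ ε₁ := by
    rw [← Real.rpow_add hN0]; congr 1; rw [hε₁d]; ring
  have h2split : N ^ (2 : ℕ) = N ^ (2 * θ) * N ^ ε₂ := by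
    rw [← Real.rpow_natCast, ← Real.rpow_add hN0]; congr 1; rw [hε₂d]; push_cast; ring
  rw [hγsplit, h2split] at hm
  have hm' : 1 ≤ 4 * (C / N ^ ε₁) + 4 * (Cj / N ^ ε₂) := by
    have h := mul_le_mul_of_nonneg_left hm (by positivity : (0 : ℝ) ≤ 4 * N ^ (2 * θ))
    have e1 : 4 * N ^ (2 * θ) * (1 / (4 * N ^ (2 * θ))) = 1 := by
      field_simp
    have e2 : 4 * N ^ (2 * θ) * (C / (N ^ (2 * θ) * N ^ ε₁) + Cj / (N ^ (2 * θ) * N ^ ε₂))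
        = 4 * (C / N ^ ε₁) + 4 * (Cj / N ^ ε₂) := by
      field_simp
    rwa [e1, e2] at h
  have hc1 : C / N ^ ε₁ < 1 / 8 := by
    calc C / N ^ ε₁ ≤ |C| / N ^ ε₁ := div_le_div_of_nonneg_right (le_abs_self C) hE₁.le
      _ < 1 / 8 := by rw [div_lt_iff₀ hE₁]; linarith
  have hc2 : Cj / N ^ ε₂ < 1 / 8 := by rw [div_lt_iff₀ hE₂]; linarith
  linarith

/-- **ORDER-TWO, WEIGHTS `W^θ∂ ⊗ W^θ∂`: NO eta-rate `N^{−γ}` WITH `γ > 2θ` (`0 ≤ θ < 1`, `d ≥ 1`,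
`a > 0`, every constant `C`).**  Witness: `R = 2`, fibre `p′ = π e_{μ₁}`, the unpaired on-axis class
`K = (N−1) e_{μ₁}` of level `2N` — the planted level-`N` term vanishes there and the level-`2N` diagonal
entry is `(1/(2N−1))^{2θ} + O(N^{−2})`.  With `B5G183RateWTheta.orderTwoOpRateResidualWθ_one_holds`
(`θ = 1 ⇒ γ = 1`) and the companion positive module (`γ = min(2θ,1)` for `θ ∈ [0,1]`) this makes the
exponent `2θ` SHARP on `[0, 1/2]`. [cite: Balaban1984PropagatorsI, Prop. 1.1 (1.89) p.33, (1.83) p.31;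
King1986, (4.19)–(4.20), (4.23) p.672, p.673] [folklore] -/
theorem not_orderTwoOpRateResidualWθ_of_lt (μ₁ : Fin d) (a : ℝ) (ha : 0 < a) {C θ γ : ℝ}
    (hθ0 : 0 ≤ θ) (hθ1 : θ < 1) (hγ : 2 * θ < γ) : ¬ OrderTwoOpRateResidualWθ d a C θ γ := by
  intro h
  have hCj := Cjunk_nonneg d ha
  have hT₁0 : 0 ≤ (8 * |C| + 1) ^ (1 / (γ - 2 * θ)) := Real.rpow_nonneg (by positivity) _
  have hT₂0 : 0 ≤ (8 * Cjunk d a + 1) ^ (1 / (2 - 2 * θ)) := Real.rpow_nonneg (by positivity) _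
  obtain ⟨M, hM⟩ := exists_nat_ge ((8 * |C| + 1) ^ (1 / (γ - 2 * θ))
    + (8 * Cjunk d a + 1) ^ (1 / (2 - 2 * θ)))
  haveI : NeZero (M + 2) := ⟨by omega⟩
  have hM0 : (0 : ℝ) ≤ M := Nat.cast_nonneg M
  have hNM : ((M + 2 : ℕ) : ℝ) = (M : ℝ) + 2 := by push_cast; ring
  have hN2 : (2 : ℝ) ≤ ((M + 2 : ℕ) : ℝ) := by rw [hNM]; linarith
  have hN0 : (0 : ℝ) < ((M + 2 : ℕ) : ℝ) := by linarith
  have hT₁ : (8 * |C| + 1) ^ (1 / (γ - 2 * θ)) ≤ ((M + 2 : ℕ) : ℝ) := by rw [hNM]; linarith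
  have hT₂ : (8 * Cjunk d a + 1) ^ (1 / (2 - 2 * θ)) ≤ ((M + 2 : ℕ) : ℝ) := by rw [hNM]; linarith
  -- the witness entry is dominated by the operator norm
  have hent := (norm_apply_le_norm (XW M μ₁ a ha θ) (KW M μ₁, μ₁) (KW M μ₁, μ₁)).trans
    (opNorm_XW_le h M μ₁ ha)
  rw [XW_entry M μ₁ a ha θ, Gfor_diag, weight_mul_diag, main_KW] at hent
  have hJ := junk_KW_le M μ₁ a ha hθ0
  -- main term ≤ C/N^γ + Cj/N²
  have hmain : (((1 : ℝ) / (2 * M + 3)) ^ θ) ^ 2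
      ≤ C / ((M + 2 : ℕ) : ℝ) ^ γ + Cjunk d a / ((M + 2 : ℕ) : ℝ) ^ 2 := by
    have h1 := norm_sub_le
      ((((((1 : ℝ) / (2 * M + 3)) ^ θ) ^ 2 : ℝ) : ℂ)
        + ((‖wθdSym (2 * (M + 2)) θ (KW M μ₁) (sWit μ₁) μ₁‖ ^ 2 : ℝ) : ℂ)
          * (rEnt (2 * (M + 2)) a μ₁ μ₁ (sWit μ₁) (KW M μ₁) (KW M μ₁)
            - xEnt (2 * (M + 2)) a μ₁ (sWit μ₁) (KW M μ₁) (KW M μ₁)))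
      (((‖wθdSym (2 * (M + 2)) θ (KW M μ₁) (sWit μ₁) μ₁‖ ^ 2 : ℝ) : ℂ)
          * (rEnt (2 * (M + 2)) a μ₁ μ₁ (sWit μ₁) (KW M μ₁) (KW M μ₁)
            - xEnt (2 * (M + 2)) a μ₁ (sWit μ₁) (KW M μ₁) (KW M μ₁)))
    rw [add_sub_cancel_right, Complex.norm_real, Real.norm_eq_abs, abs_of_nonneg (sq_nonneg _)] at h1
    linarith
  -- lower bound of the main term: (1/(2M+3))^{2θ} ≥ (1/(2N))^{2θ} ≥ 1/(4 N^{2θ})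
  have hW0 : (0 : ℝ) ≤ 1 / (2 * M + 3) := by positivity
  have hsq : (((1 : ℝ) / (2 * M + 3)) ^ θ) ^ 2 = ((1 : ℝ) / (2 * M + 3)) ^ (2 * θ) := by
    rw [← Real.rpow_two, ← Real.rpow_mul hW0]; congr 1; ring
  have hWN : 1 / (2 * ((M + 2 : ℕ) : ℝ)) ≤ (1 : ℝ) / (2 * M + 3) :=
    div_le_div_of_nonneg_left zero_le_one (by positivity) (by rw [hNM]; linarith)
  have hlow : 1 / (4 * ((M + 2 : ℕ) : ℝ) ^ (2 * θ)) ≤ (((1 : ℝ) / (2 * M + 3)) ^ θ) ^ 2 := by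
    rw [hsq]
    have h22 : (2 : ℝ) ^ (2 * θ) ≤ 4 :=
      calc (2 : ℝ) ^ (2 * θ) ≤ (2 : ℝ) ^ (2 : ℝ) :=
            Real.rpow_le_rpow_of_exponent_le (by norm_num) (by linarith)
        _ = 4 := by rw [Real.rpow_two]; norm_num
    calc 1 / (4 * ((M + 2 : ℕ) : ℝ) ^ (2 * θ))
        ≤ 1 / ((2 * ((M + 2 : ℕ) : ℝ)) ^ (2 * θ)) := by
          refine div_le_div_of_nonneg_left zero_le_one (Real.rpow_pos_of_pos (by positivity) _) ?_
          rw [Real.mul_rpow (by norm_num) hN0.le]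
          exact mul_le_mul_of_nonneg_right h22 (Real.rpow_nonneg hN0.le _)
      _ = (1 / (2 * ((M + 2 : ℕ) : ℝ))) ^ (2 * θ) := by
          rw [Real.div_rpow zero_le_one (by positivity), Real.one_rpow]
      _ ≤ ((1 : ℝ) / (2 * M + 3)) ^ (2 * θ) := Real.rpow_le_rpow (by positivity) hWN (by linarith)
  exact numeric_coreθ hN2 hθ1 hγ hCj (hlow.trans hmain) hT₁ hT₂

/-- hence no constant works: `¬ ∃ C, OrderTwoOpRateResidualWθ d a C θ γ` for `γ > 2θ`, `0 ≤ θ < 1`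
(`d ≥ 1`, `a > 0`). [folklore] -/
theorem no_orderTwoOpRateWθ_of_lt (μ₁ : Fin d) (a : ℝ) (ha : 0 < a) {θ γ : ℝ} (hθ0 : 0 ≤ θ)
    (hθ1 : θ < 1) (hγ : 2 * θ < γ) : ¬ ∃ C, OrderTwoOpRateResidualWθ d a C θ γ :=
  fun ⟨_, hC⟩ => not_orderTwoOpRateResidualWθ_of_lt μ₁ a ha hθ0 hθ1 hγ hC

/-- in particular the UNWEIGHTED order-two residual (`θ = 0`) has no rate `N^{−γ}` for ANY `γ > 0`,
already in `d = 1` (compare `B5G183RateWTheta.not_orderTwoOpRateResidualWθ_zero`: `γ = 1`, `d ≥ 2`).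
[folklore] -/
theorem not_orderTwoOpRateResidualWθ_zero_of_pos (μ₁ : Fin d) (a : ℝ) (ha : 0 < a) (C : ℝ) {γ : ℝ}
    (hγ : 0 < γ) : ¬ OrderTwoOpRateResidualWθ d a C 0 γ :=
  not_orderTwoOpRateResidualWθ_of_lt μ₁ a ha le_rfl zero_lt_one (by linarith)

end NoGo

end Literature.MathematicalPhysics.QuantumFieldTheory.Balaban1983to89.B5G183RateWThetaSharp
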